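import Mathlib
import Literature.Probability.LatticeModels.ScalingLimit
import Literature.Barriers.CriticalPhenomena.ScaleCovarianceNotMoebius
import Summits.CriticalPhenomena.Ising3DConformalLimit.Theorems.PrecisionLaplacianMoebiusLimitOfTwoPointLawExistenceAndInversion
import HarnessLib

/-!
# Kelvin transform of the vertex-measure representation of the four-point function
# (crux `MoebiusLimitOfTwoPointLaw`, item stmt-CriticalPhenomena-4801; line `Sketch` = card
# `amputated-lebowitz-vertex-measure`, stub `stub_inversionOfVertexCovariance`;
# `--supports stmt-CriticalPhenomena-4801`)

Pure measure theory on `ℝ³`, nothing Ising-specific. Let `ι = inversion 0 1` be the unit inversion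
(`ι y = ‖y‖⁻² y`) and let `T₄ : (ℝ³)⁴ → ℝ` be any function whose "connected part" with respect to the
two-point function `c‖x − y‖^{-2Δ}` is, in the first variable, minus the Riesz potential of a measure
`ν_X` depending on the remaining triple `X`:
`T₄(x₁, X) − Wick_c(x₁, X) = −∫ c‖x₁ − z‖^{-2Δ} dν_X(z)` at non-coincident `(x₁, X)`.
IF the measures transform under `ι` by the Kelvin law
`ν_{ιX} = (∏ⱼ ‖Xⱼ‖^{2Δ}) · ι_*(‖z‖^{-2Δ} ν_X)` for injective triples `X` off the origin, and have no
atom at the origin there, THEN `T₄ (ι x) = (∏ᵢ ‖xᵢ‖^{2Δ}) T₄ x` at every non-coincident `x` off the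
origin (`stub_inversionOfVertexCovariance`, the registered signature of the line's skeleton
`Cruxes/MoebiusLimitOfTwoPointLaw/Lines/Sketch.lean`).

Proof. `‖ι x₁ − ι z‖ = ‖x₁ − z‖ / (‖x₁‖ ‖z‖)` (Mathlib `dist_inversion_inversion`, packaged as
`ScaleNotMoebius.twoPt_inversion`) gives the pointwise identity
`‖z‖^{-2Δ} ‖ι x₁ − ι z‖^{-2Δ} = ‖x₁‖^{2Δ} ‖x₁ − z‖^{-2Δ}` for `z ≠ 0` (`vertexKelvin_kernel`); the
change of variables `integral_smul_measure` + `integral_map` + `integral_withDensity_eq_integral_toReal_smul`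
and `ν_X {0} = 0` turn `∫ c‖ι x₁ − w‖^{-2Δ} dν_{ιX}(w)` into
`(∏ⱼ ‖Xⱼ‖^{2Δ}) ‖x₁‖^{2Δ} ∫ c‖x₁ − z‖^{-2Δ} dν_X(z)` (`vertexKelvin_potential`); the Wick part is
covariant term by term with the same total weight (`twoPt_inversion` on each of the two pairs of a
pairing), and `linear_combination` of the two representation identities closes
(`vertexKelvin_cons`, then `stub_inversionOfVertexCovariance` by splitting `x = (x 0, Fin.tail x)`).
References: Landkof, *Foundations of Modern Potential Theory* (1972), Ch. IV §5 (Kelvin transform of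
Riesz potentials); Di Francesco–Mathieu–Sénéchal (1997) §4.1. No definitions, no `sorry`. [folklore]
-/

noncomputable section

namespace Summit.CriticalPhenomena.Ising3DConformalLimit.PrecisionLaplacianMoebiusLimitOfTwoPointLaw

open Literature.Probability.LatticeModels Filter Topology EuclideanGeometry MeasureTheory
open Literature.Barriers.CriticalPhenomena.ScaleNotMoebius (twoPt twoPt_inversion)

/-! ### The unit inversion and the Riesz kernel -/

/-- The unit inversion `ι = inversion 0 1` of `ℝ³` is Borel measurable (it is continuous off the
origin, Mathlib `ContinuousOn.inversion`). [folklore] -/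
theorem vertexKelvin_measurable_inversion :
    Measurable (inversion (0 : EuclideanSpace ℝ (Fin 3)) 1) :=
  measurable_of_continuousOn_compl_singleton 0
    (ContinuousOn.inversion continuousOn_const continuousOn_const continuousOn_id fun _ ha => ha)

/-- Pointwise Kelvin identity for the Riesz kernel: for `x₁ ≠ 0` and `z ≠ 0`,
`‖z‖^{-2Δ} ‖ι x₁ − ι z‖^{-2Δ} = ‖x₁‖^{2Δ} ‖x₁ − z‖^{-2Δ}` (from
`‖ι x₁ − ι z‖ = ‖x₁ − z‖ / (‖x₁‖ ‖z‖)`). [folklore] -/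
theorem vertexKelvin_kernel (Δ : ℝ) {x₁ z : EuclideanSpace ℝ (Fin 3)} (hx₁ : x₁ ≠ 0) (hz : z ≠ 0) :
    ‖z‖ ^ (-(2 * Δ)) * ‖inversion 0 1 x₁ - inversion 0 1 z‖ ^ (-(2 * Δ)) =
      ‖x₁‖ ^ (2 * Δ) * ‖x₁ - z‖ ^ (-(2 * Δ)) := by
  have h : ‖inversion 0 1 x₁ - inversion 0 1 z‖ ^ (-(2 * Δ)) =
      ‖x₁‖ ^ (2 * Δ) * ‖z‖ ^ (2 * Δ) * ‖x₁ - z‖ ^ (-(2 * Δ)) := twoPt_inversion Δ hx₁ hz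
  have hz' : ‖z‖ ^ (2 * Δ) ≠ 0 := (Real.rpow_pos_of_pos (norm_pos_iff.mpr hz) _).ne'
  rw [h, Real.rpow_neg (norm_nonneg z)]
  field_simp

/-- **Kelvin transform of a Riesz potential.** For a measure `μ` on `ℝ³` without atom at the
origin, `P ≥ 0` and `x₁ ≠ 0`:
`∫ c‖ι x₁ − w‖^{-2Δ} d(P • ι_*(‖z‖^{-2Δ} μ))(w) = P ‖x₁‖^{2Δ} ∫ c‖x₁ − z‖^{-2Δ} dμ(z)`
(change of variables under the push-forward and the density, then `vertexKelvin_kernel` `μ`-a.e.).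
[folklore] -/
theorem vertexKelvin_potential (Δ c P : ℝ) (hP : 0 ≤ P) (μ : Measure (EuclideanSpace ℝ (Fin 3)))
    (hμ0 : μ {0} = 0) {x₁ : EuclideanSpace ℝ (Fin 3)} (hx₁ : x₁ ≠ 0) :
    ∫ w, c * ‖inversion 0 1 x₁ - w‖ ^ (-(2 * Δ))
        ∂(ENNReal.ofReal P •
          Measure.map (inversion (0 : EuclideanSpace ℝ (Fin 3)) 1)
            (μ.withDensity fun z => ENNReal.ofReal (‖z‖ ^ (-(2 * Δ))))) =
      P * (‖x₁‖ ^ (2 * Δ) * ∫ z, c * ‖x₁ - z‖ ^ (-(2 * Δ)) ∂μ) := by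
  have hf : Measurable fun w : EuclideanSpace ℝ (Fin 3) =>
      c * ‖inversion 0 1 x₁ - w‖ ^ (-(2 * Δ)) :=
    ((measurable_const.sub measurable_id).norm.pow_const _).const_mul c
  have hρ : Measurable fun z : EuclideanSpace ℝ (Fin 3) => ENNReal.ofReal (‖z‖ ^ (-(2 * Δ))) :=
    (measurable_norm.pow_const _).ennreal_ofReal
  rw [integral_smul_measure,
    integral_map vertexKelvin_measurable_inversion.aemeasurable hf.aestronglyMeasurable,
    integral_withDensity_eq_integral_toReal_smul hρ
      (Eventually.of_forall fun _ => ENNReal.ofReal_lt_top),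
    ENNReal.toReal_ofReal hP, smul_eq_mul, ← integral_const_mul (‖x₁‖ ^ (2 * Δ))]
  congr 1
  refine integral_congr_ae ?_
  filter_upwards [measure_eq_zero_iff_ae_notMem.1 hμ0] with z hz
  have hz0 : z ≠ 0 := fun h => hz (Set.mem_singleton_iff.2 h)
  rw [ENNReal.toReal_ofReal (Real.rpow_nonneg (norm_nonneg z) _), smul_eq_mul, mul_left_comm,
    vertexKelvin_kernel Δ hx₁ hz0]
  ring

/-! ### The four-point Kelvin transform -/

/-- **Kelvin transform of the vertex-measure representation, `(x₁, X)` form.** If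
`T₄(x₁, X) − Wick_c(x₁, X) = −∫ c‖x₁ − z‖^{-2Δ} dν_X(z)` at non-coincident `(x₁, X)`, the measures
obey the Kelvin law `ν_{ιX} = (∏ⱼ ‖Xⱼ‖^{2Δ}) · ι_*(‖z‖^{-2Δ} ν_X)` for injective `X` off the origin and
have no atom at the origin there, then for non-coincident `(x₁, X)` off the origin
`T₄(ι x₁, ι X) = ‖x₁‖^{2Δ} (∏ⱼ ‖Xⱼ‖^{2Δ}) T₄(x₁, X)`: the potential transforms by
`vertexKelvin_potential`, the Wick part term by term (`twoPt_inversion`). [folklore] -/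
theorem vertexKelvin_cons {Δ c : ℝ} (T4 : (Fin 4 → EuclideanSpace ℝ (Fin 3)) → ℝ)
    (ν : (Fin 3 → EuclideanSpace ℝ (Fin 3)) → Measure (EuclideanSpace ℝ (Fin 3)))
    (hrep : ∀ (X : Fin 3 → EuclideanSpace ℝ (Fin 3)) (x₁ : EuclideanSpace ℝ (Fin 3)),
      Matrix.vecCons x₁ X ∈ NonCoincident 3 4 →
        Integrable (fun z => c * ‖x₁ - z‖ ^ (-(2 * Δ))) (ν X) ∧
        T4 (Matrix.vecCons x₁ X) -
            (c * ‖x₁ - X 0‖ ^ (-(2 * Δ)) * (c * ‖X 1 - X 2‖ ^ (-(2 * Δ))) +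
              c * ‖x₁ - X 1‖ ^ (-(2 * Δ)) * (c * ‖X 0 - X 2‖ ^ (-(2 * Δ))) +
              c * ‖x₁ - X 2‖ ^ (-(2 * Δ)) * (c * ‖X 0 - X 1‖ ^ (-(2 * Δ)))) =
          -∫ z, c * ‖x₁ - z‖ ^ (-(2 * Δ)) ∂(ν X))
    (hcov : ∀ X : Fin 3 → EuclideanSpace ℝ (Fin 3), (∀ j, X j ≠ 0) → Function.Injective X →
      ν (fun j => inversion 0 1 (X j)) =
        ENNReal.ofReal (∏ j, ‖X j‖ ^ (2 * Δ)) •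
          Measure.map (inversion (0 : EuclideanSpace ℝ (Fin 3)) 1)
            ((ν X).withDensity fun z => ENNReal.ofReal (‖z‖ ^ (-(2 * Δ)))))
    (h0 : ∀ X : Fin 3 → EuclideanSpace ℝ (Fin 3), (∀ j, X j ≠ 0) → ν X {0} = 0)
    (X : Fin 3 → EuclideanSpace ℝ (Fin 3)) (x₁ : EuclideanSpace ℝ (Fin 3))
    (hmem : Matrix.vecCons x₁ X ∈ NonCoincident 3 4) (hx₁ : x₁ ≠ 0) (hX0 : ∀ j, X j ≠ 0) :
    T4 (Matrix.vecCons (inversion 0 1 x₁) fun j => inversion 0 1 (X j)) =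
      ‖x₁‖ ^ (2 * Δ) * (∏ j, ‖X j‖ ^ (2 * Δ)) * T4 (Matrix.vecCons x₁ X) := by
  have hXinj : Function.Injective X := (Fin.cons_injective_iff.1 ((mem_nonCoincident _).1 hmem)).2
  have hmem' : (Matrix.vecCons (inversion 0 1 x₁) fun j => inversion 0 1 (X j)) ∈
      NonCoincident 3 4 := by
    have h := (inversion_mem_nonCoincident_iff (Matrix.vecCons x₁ X)).2 hmem
    convert h using 1
    funext i
    refine Fin.cases ?_ (fun j => ?_) i <;> simp
  have hP : 0 ≤ ∏ j, ‖X j‖ ^ (2 * Δ) :=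
    Finset.prod_nonneg fun j _ => Real.rpow_nonneg (norm_nonneg _) _
  have hp : ∀ {a b : EuclideanSpace ℝ (Fin 3)}, a ≠ 0 → b ≠ 0 →
      ‖inversion 0 1 a - inversion 0 1 b‖ ^ (-(2 * Δ)) =
        ‖a‖ ^ (2 * Δ) * ‖b‖ ^ (2 * Δ) * ‖a - b‖ ^ (-(2 * Δ)) :=
    fun ha hb => twoPt_inversion Δ ha hb
  obtain ⟨-, h1⟩ := hrep X x₁ hmem
  obtain ⟨-, h2⟩ := hrep (fun j => inversion 0 1 (X j)) (inversion 0 1 x₁) hmem'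
  rw [hcov X hX0 hXinj,
    vertexKelvin_potential Δ c (∏ j, ‖X j‖ ^ (2 * Δ)) hP (ν X) (h0 X hX0) hx₁] at h2
  simp only [hp hx₁ (hX0 _), hp (hX0 _) (hX0 _), Fin.prod_univ_three] at h2
  rw [Fin.prod_univ_three]
  linear_combination
    h2 - ‖x₁‖ ^ (2 * Δ) * (‖X 0‖ ^ (2 * Δ) * ‖X 1‖ ^ (2 * Δ) * ‖X 2‖ ^ (2 * Δ)) * h1

/-- **Stub `stub_inversionOfVertexCovariance` of line `Sketch` (Kelvin transform; registered
signature).** If the connected part of `T₄` (two-point function `c‖·‖^{-2Δ}`, `0 < c`, `0 < Δ`) is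
`−∫ c‖x₁ − z‖^{-2Δ} dν_X(z)` for finite measures `ν_X` that transform under the unit inversion by
the Kelvin law `ν_{ιX} = (∏ⱼ ‖Xⱼ‖^{2Δ}) · ι_*(‖z‖^{-2Δ} ν_X)` and have no atom at the origin for `X`
off the origin, then `T₄` is unit-inversion covariant with weight `Δ` at non-coincident
configurations off the origin: `T₄ (ι x) = (∏ᵢ ‖xᵢ‖^{2Δ}) T₄ x`. (Finiteness, integrability, `0 < c`
and `0 < Δ` are part of the registered interface but not needed: Bochner integrals of
non-integrable functions vanish on both sides of the change of variables.) [folklore] -/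
theorem stub_inversionOfVertexCovariance :
    ∀ Δ c : ℝ, 0 < c → 0 < Δ →
      ∀ (T4 : (Fin 4 → EuclideanSpace ℝ (Fin 3)) → ℝ)
        (ν : (Fin 3 → EuclideanSpace ℝ (Fin 3)) → Measure (EuclideanSpace ℝ (Fin 3))),
        (∀ X, IsFiniteMeasure (ν X)) →
        (∀ (X : Fin 3 → EuclideanSpace ℝ (Fin 3)) (x₁ : EuclideanSpace ℝ (Fin 3)),
          Matrix.vecCons x₁ X ∈ NonCoincident 3 4 →
            Integrable (fun z => c * ‖x₁ - z‖ ^ (-(2 * Δ))) (ν X) ∧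
            T4 (Matrix.vecCons x₁ X) -
                (c * ‖x₁ - X 0‖ ^ (-(2 * Δ)) * (c * ‖X 1 - X 2‖ ^ (-(2 * Δ))) +
                  c * ‖x₁ - X 1‖ ^ (-(2 * Δ)) * (c * ‖X 0 - X 2‖ ^ (-(2 * Δ))) +
                  c * ‖x₁ - X 2‖ ^ (-(2 * Δ)) * (c * ‖X 0 - X 1‖ ^ (-(2 * Δ)))) =
              -∫ z, c * ‖x₁ - z‖ ^ (-(2 * Δ)) ∂(ν X)) →
        (∀ X : Fin 3 → EuclideanSpace ℝ (Fin 3), (∀ j, X j ≠ 0) → Function.Injective X →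
          ν (fun j => inversion 0 1 (X j)) =
            ENNReal.ofReal (∏ j, ‖X j‖ ^ (2 * Δ)) •
              Measure.map (inversion (0 : EuclideanSpace ℝ (Fin 3)) 1)
                ((ν X).withDensity fun z => ENNReal.ofReal (‖z‖ ^ (-(2 * Δ))))) →
        (∀ X : Fin 3 → EuclideanSpace ℝ (Fin 3), (∀ j, X j ≠ 0) → ν X {0} = 0) →
        ∀ x ∈ NonCoincident 3 4, (∀ i, x i ≠ 0) →
          T4 (fun i => inversion 0 1 (x i)) = (∏ i, ‖x i‖ ^ (2 * Δ)) * T4 x := by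
  intro Δ c _hc _hΔ T4 ν _hfin hrep hcov h0 x hx hx0
  have hxc : Matrix.vecCons (x 0) (Fin.tail x) = x := Fin.cons_self_tail x
  have hιc : (Matrix.vecCons (inversion 0 1 (x 0)) fun j => inversion 0 1 (Fin.tail x j)) =
      fun i => inversion 0 1 (x i) :=
    Fin.cons_self_tail (fun i => inversion 0 1 (x i))
  have key := vertexKelvin_cons T4 ν hrep hcov h0 (Fin.tail x) (x 0) (by rwa [hxc]) (hx0 0)
    fun j => hx0 j.succ
  rw [hxc, hιc] at key
  rw [Fin.prod_univ_succ]
  exact key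

end Summit.CriticalPhenomena.Ising3DConformalLimit.PrecisionLaplacianMoebiusLimitOfTwoPointLaw

end
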